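import Summits.CriticalPhenomena.PercolationContinuityZ3.Theorems.Transplant.FKConnectivityAllQPat3ThetaJoin
import HarnessLib

/-!
# Connectivity correlation inequalities for `φ_{w,q}`, every `q > 0` — THE RING GLUING (Stage S2, part 1c): patterns, antipodal
# exponent and the TRILINEAR decomposition of a three-mark table over the ring `K(v,u;b) · Q₁(u,w;s) · Q₂(w,v;t)`

Definitions + theorems file (`--supports stmt-CriticalPhenomena-4575`), census lane `prim-bschramm-census` (gen 36) of the post-continuity programme (LANE 2 bschramm, FK sub-lane);
builds on p205010 (kernel theorem, internal audit signed; external expert review pending).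
No named facts, no sorries; standard axioms.  The RING configuration of census g34's Lemma Θ₃ (three two-terminal pieces around the
corners `u, w, v`, pairwise meeting in one corner each; marks `b ∈ K`, `s ∈ Q₁`, `t ∈ Q₂` inner): **`FK.joinRing`** (pattern on
`(b, s, t)` from the pieces' patterns on `(v,u,b)`, `(u,w,s)`, `(w,v,t)`: inside `Q₁ ∪ Q₂`, glued in series at `w`, the corners `u, v`
are joined iff `u ~ w ~ v`; then `K` is glued in parallel across `{u, v}`), **`FK.corrRing`** (one cycle iff all three pieces join
their corners), `FK.reachable_union_sameside` (two points on the same side of a `{u,v}`-interface), **`FK.pat3_union3_ring`**,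
**`FK.apExp_union3_ring`** (`k+k̄+4|V| = Σ_p (k+k̄)_p + corrRing + corrRing'`; fk-2's `apExp_series` + `apExp_parallel`),
**`FK.tval_union3_ring`** (census g32's r-linear form, `r = 3`).  With `…Pat3ThetaGluing.lean` this completes the gluing layer of
Stage S2; the levelwise product-cone lemma, the certificate checker and the data remain.
[cite: AyyerLinussonRavichandran2025, §7 eq. (13)–(15) (p. 22)] [cite: Grimmett2006, §3.8 (pp. 61–62)]
-/

noncomputable section

namespace Summit.CriticalPhenomena.PercolationContinuityZ3.Theorems

namespace FK

open SimpleGraph Literature.Probability.LatticeModels Literature.Probability.Percolation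

/-! ### The RING join and level correction -/

/-- **RING join**: the pattern on the marks `(b, s, t)` of `γ_K ∪ γ₁ ∪ γ₂` for the ring `K(v,u;b) · Q₁(u,w;s) · Q₂(w,v;t)` (three
pieces around the corners `u, w, v`), from the pieces' patterns `PK` on `(v,u,b)`, `P1` on `(u,w,s)`, `P2` on `(w,v,t)`: inside
`Q₁ ∪ Q₂` (series at `w`) the corners `u, v` are joined iff `u~w~v`, and then `K` is glued in parallel across `{u, v}`
(census g32's gluing law §2.1 for the RING configuration of g34's Lemma Θ₃). [folklore] -/
def joinRing (PK P1 P2 : Pat3) : Pat3 :=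
  Pat3.ofBits
    (((PK.ys || ((PK.xy || (P1.xy && P2.xy)) && PK.xs)) && (P1.xs || ((PK.xy || (P1.xy && P2.xy)) && (P1.ys && P2.xy)))) ||
      ((PK.xs || ((PK.xy || (P1.xy && P2.xy)) && PK.ys)) && ((P1.ys && P2.xy) || ((PK.xy || (P1.xy && P2.xy)) && P1.xs))))
    (((PK.ys || ((PK.xy || (P1.xy && P2.xy)) && PK.xs)) && ((P1.xy && P2.xs) || ((PK.xy || (P1.xy && P2.xy)) && P2.ys))) ||
      ((PK.xs || ((PK.xy || (P1.xy && P2.xy)) && PK.ys)) && (P2.ys || ((PK.xy || (P1.xy && P2.xy)) && (P1.xy && P2.xs)))))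
    ((P1.ys && P2.xs) || (P1.xs && ((P1.xy && P2.xs) || ((PK.xy || (P1.xy && P2.xy)) && P2.ys))) ||
      ((P1.ys && P2.xy) && (P2.ys || ((PK.xy || (P1.xy && P2.xy)) && (P1.xy && P2.xs)))))

/-- **RING level correction**: one cycle iff all three pieces join their corner pairs. [folklore] -/
def corrRing (PK P1 P2 : Pat3) : ℕ := if PK.xy && P1.xy && P2.xy then 1 else 0

open scoped Classical

variable {V : Type*}

/-- A `Bool`/`Prop` bookkeeping lemma for the third RING bit. [folklore] -/
theorem bool_ring3_iff {a b c d e g f : Bool} {X C D E F : Prop} (hx : (a && b) = true ↔ X) (hc : c = true ↔ C)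
    (hd : d = true ↔ D) (he : (e && g) = true ↔ E) (hf : f = true ↔ F) :
    ((a && b) || (c && d) || ((e && g) && f)) = true ↔ X ∨ (C ∧ D) ∨ (E ∧ F) := by
  rw [← hx, ← hc, ← hd, ← he, ← hf]
  cases a <;> cases b <;> cases c <;> cases d <;> cases e <;> cases g <;> cases f <;> simp

section SameSide

variable {EA EB : Finset (Sym2 V)} {VA VB : Set V} {u v : V}

/-- **Two points on the SAME side of a `{u, v}`-interface** (both off the first part) are joined in the union iff they are
joined inside their part, or one reaches a corner inside the part and the corner reaches the other in the union. [folklore] -/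
theorem reachable_union_sameside (hA : ∀ e ∈ (↑EA : Set (Sym2 V)), ∀ z ∈ e, z ∈ VA)
    (hB : ∀ e ∈ (↑EB : Set (Sym2 V)), ∀ z ∈ e, z ∈ VB) (hS : VA ∩ VB ⊆ ({u, v} : Set V)) {m m' : V} (hm : m ∉ VA)
    (hm' : m' ∉ VA) (hmu : m ≠ u) (hmv : m ≠ v) (hm'u : m' ≠ u) (hm'v : m' ≠ v)
    {γA γB : Finset (Sym2 V)} (gA : γA ⊆ EA) (gB : γB ⊆ EB) :
    (openGraph (↑(γA ∪ γB) : BondConfig V)).Reachable m m' ↔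
      (openGraph (↑γB : BondConfig V)).Reachable m m' ∨
        ((openGraph (↑γB : BondConfig V)).Reachable m u ∧ (openGraph (↑(γA ∪ γB) : BondConfig V)).Reachable u m') ∨
          ((openGraph (↑γB : BondConfig V)).Reachable m v ∧ (openGraph (↑(γA ∪ γB) : BondConfig V)).Reachable v m') := by
  refine ⟨fun h => ?_, ?_⟩
  · have hωA : (↑γA : Set (Sym2 V)) ⊆ ↑EA := Finset.coe_subset.2 gA
    have hωB : (↑γB : Set (Sym2 V)) ⊆ ↑EB := Finset.coe_subset.2 gB
    rw [Finset.coe_union] at h ⊢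
    obtain ⟨p⟩ := h
    have hS' : VA ∩ VB ⊆ ({u, v, m'} : Set V) := by
      intro z hz
      rcases hS hz with h | h
      · exact Or.inl h
      · exact Or.inr (Or.inl h)
    obtain ⟨s', hs'S, hside, hchain⟩ := GZGluing.walk_split hA hB hS' hωA hωB p (by simp)
    have hA' : ∀ a c, a ∈ ({z | (openGraph ((↑γA : Set (Sym2 V)) ∪ ↑γB)).Reachable s' z} : Set V) →
        (a ∈ ({u, v, m'} : Set V) ∧ c ∈ ({u, v, m'} : Set V) ∧
          ((openGraph (↑γA : BondConfig V)).Reachable a c ∨ (openGraph (↑γB : BondConfig V)).Reachable a c)) →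
        c ∈ ({z | (openGraph ((↑γA : Set (Sym2 V)) ∪ ↑γB)).Reachable s' z} : Set V) :=
      fun a c ha hac => Reachable.trans ha (GZGluing.reachable_union_of_side hac.2.2)
    have hrest : (openGraph ((↑γA : Set (Sym2 V)) ∪ ↑γB)).Reachable s' m' :=
      GZGluing.reflTransGen_mem hA' hchain (Reachable.refl _)
    -- the first segment lies in `γB` (or is trivial)
    have hfirst : (openGraph (↑γB : BondConfig V)).Reachable m s' := by
      rcases hside with h | h
      · by_cases hms : m = s'
        · subst hms; exact Reachable.refl _
        · exact absurd (GZGluing.mem_of_reachable_ne hA hωA h hms) hm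
      · exact h
    rcases hs'S with h' | h' | h'
    · subst h'; exact Or.inr (Or.inl ⟨hfirst, hrest⟩)
    · subst h'; exact Or.inr (Or.inr ⟨hfirst, hrest⟩)
    · rw [Set.mem_singleton_iff] at h'
      subst h'
      exact Or.inl hfirst
  · rintro (h | ⟨h1, h2⟩ | ⟨h1, h2⟩)
    · rw [Finset.coe_union]; exact GZGluing.reachable_union_of_side (Or.inr h)
    · exact ((show (openGraph (↑(γA ∪ γB) : BondConfig V)).Reachable m u from by
        rw [Finset.coe_union]; exact GZGluing.reachable_union_of_side (Or.inr h1))).trans h2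
    · exact ((show (openGraph (↑(γA ∪ γB) : BondConfig V)).Reachable m v from by
        rw [Finset.coe_union]; exact GZGluing.reachable_union_of_side (Or.inr h1))).trans h2

end SameSide

section Ring

variable {EK E₁ E₂ : Finset (Sym2 V)} {VK V₁ V₂ : Set V} {u v w : V}

/-- Interface of `K` with `Q₁ ∪ Q₂` in a ring: inside `{u, v}`. [folklore] -/
theorem ring_inter_subset_pair (hK1 : VK ∩ V₁ ⊆ ({u} : Set V)) (hK2 : VK ∩ V₂ ⊆ ({v} : Set V)) :
    VK ∩ (V₁ ∪ V₂) ⊆ ({u, v} : Set V) := by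
  rintro z ⟨hzK, hz | hz⟩
  · exact Or.inl (hK1 ⟨hzK, hz⟩)
  · exact Or.inr (hK2 ⟨hzK, hz⟩)

/-- **PATTERN GLUING FOR THE RING CONFIGURATION** (census g34 Lemma Θ₃ / g32 §2.1): for the ring `K(v,u;b) · Q₁(u,w;s) · Q₂(w,v;t)`
(edge sets on `V_K, V₁, V₂` with `V_K ∩ V₁ ⊆ {u}`, `V₁ ∩ V₂ ⊆ {w}`, `V_K ∩ V₂ ⊆ {v}`; corners `u ∉ V₂`, `v ∉ V₁`; marks off
the other pieces and off the corners), the pattern of `γ_K ∪ γ₁ ∪ γ₂` on `(b, s, t)` is `joinRing` of the pieces' patterns on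
`(v, u, b)`, `(u, w, s)`, `(w, v, t)`. [folklore] -/
theorem pat3_union3_ring (hK : ∀ e ∈ (↑EK : Set (Sym2 V)), ∀ z ∈ e, z ∈ VK)
    (h₁ : ∀ e ∈ (↑E₁ : Set (Sym2 V)), ∀ z ∈ e, z ∈ V₁) (h₂ : ∀ e ∈ (↑E₂ : Set (Sym2 V)), ∀ z ∈ e, z ∈ V₂)
    (hK1 : VK ∩ V₁ ⊆ ({u} : Set V)) (h12 : V₁ ∩ V₂ ⊆ ({w} : Set V)) (hK2 : VK ∩ V₂ ⊆ ({v} : Set V))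
    (hu2 : u ∉ V₂) (hv1 : v ∉ V₁) (huv : u ≠ v) (huw : u ≠ w) (hvw : v ≠ w)
    {b s t : V} (hb1 : b ∉ V₁) (hb2 : b ∉ V₂) (hsK : s ∉ VK) (hs2 : s ∉ V₂) (htK : t ∉ VK) (ht1 : t ∉ V₁)
    (hbu : b ≠ u) (hbv : b ≠ v) (hsu : s ≠ u) (hsv : s ≠ v) (hsw : s ≠ w) (htu : t ≠ u) (htv : t ≠ v) (htw : t ≠ w)
    (hbs : b ≠ s) (hbt : b ≠ t) (hst : s ≠ t)
    {γK γ₁ γ₂ : Finset (Sym2 V)} (gK : γK ⊆ EK) (g₁ : γ₁ ⊆ E₁) (g₂ : γ₂ ⊆ E₂) :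
    pat3 (γK ∪ γ₁ ∪ γ₂) b s t = joinRing (pat3 γK v u b) (pat3 γ₁ u w s) (pat3 γ₂ w v t) := by
  -- the two-part presentation `K ∪ B`, `B = Q₁ ∪ Q₂`
  have hB : ∀ e ∈ (↑(E₁ ∪ E₂) : Set (Sym2 V)), ∀ z ∈ e, z ∈ V₁ ∪ V₂ := edges_union_verts h₁ h₂
  have hSB : VK ∩ (V₁ ∪ V₂) ⊆ ({u, v} : Set V) := ring_inter_subset_pair hK1 hK2
  have gB : γ₁ ∪ γ₂ ⊆ E₁ ∪ E₂ := Finset.union_subset_union g₁ g₂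
  have hU : γK ∪ γ₁ ∪ γ₂ = γK ∪ (γ₁ ∪ γ₂) := Finset.union_assoc _ _ _
  -- inside `B`: series at `w`
  have Buv := reachable_union_series h₁ h₂ h12 hu2 hv1 huw hvw huv g₁ g₂
  have Bus := reachable_union_off_right h₁ h₂ h12 hu2 hs2 g₁ g₂ (u := u) (v := s)
  have Bsw := reachable_union_mid_left h₁ h₂ h12 hs2 g₁ g₂ (u := s)
  have Bsv := reachable_union_series h₁ h₂ h12 hs2 hv1 hsw hvw hsv g₁ g₂
  have Bvt := reachable_union_off_left h₁ h₂ h12 hv1 ht1 g₁ g₂ (u := v) (v := t)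
  have Bwt := reachable_union_mid_right h₁ h₂ h12 ht1 g₁ g₂ (u := t)
  have But := reachable_union_series h₁ h₂ h12 hu2 ht1 huw htw (Ne.symm htu) g₁ g₂
  have Bst := reachable_union_series h₁ h₂ h12 hs2 ht1 hsw htw hst g₁ g₂
  -- across `{u, v}`
  have pc : ({v, u} : Set V) = {u, v} := Set.pair_comm _ _
  have Uuv : (openGraph (↑(γK ∪ (γ₁ ∪ γ₂)) : BondConfig V)).Reachable u v ↔
      (openGraph (↑γK : BondConfig V)).Reachable u v ∨ (openGraph (↑(γ₁ ∪ γ₂) : BondConfig V)).Reachable u v :=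
    reachable_union_parallel hK hB hSB gK gB
  have hbB : b ∉ V₁ ∪ V₂ := fun h => h.elim hb1 hb2
  have Uus := reachable_union_par_third hK hB hSB hsK hsu hsv gK gB
  have Uvs := reachable_union_par_third (x := v) (y := u) hK hB (by rwa [pc]) hsK hsv hsu gK gB
  have Uut := reachable_union_par_third hK hB hSB htK htu htv gK gB
  have Uvt := reachable_union_par_third (x := v) (y := u) hK hB (by rwa [pc]) htK htv htu gK gB
  have hSB' : (V₁ ∪ V₂) ∩ VK ⊆ ({u, v} : Set V) := fun z hz => hSB ⟨hz.2, hz.1⟩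
  have Uub := reachable_union_par_third hB hK hSB' hbB hbu hbv gB gK
  rw [Finset.union_comm (γ₁ ∪ γ₂)] at Uub
  have Uvb := reachable_union_par_third (x := v) (y := u) hB hK (by rwa [pc]) hbB hbv hbu gB gK
  rw [Finset.union_comm (γ₁ ∪ γ₂)] at Uvb
  have Ubs := reachable_union_marks hK hB hSB (m := b) (m' := s) hbB hsK hbu hbv hbs gK gB
  have Ubt := reachable_union_marks hK hB hSB (m := b) (m' := t) hbB htK hbu hbv hbt gK gB
  have Ust := reachable_union_sameside hK hB hSB (m := s) (m' := t) hsK htK hsu hsv htu htv gK gB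
  -- bits of the pieces
  have bK1 := pat3_xy_iff γK v u b
  have bK2 := pat3_xs_iff γK v u b
  have bK3 := pat3_ys_iff γK v u b
  have b11 := pat3_xy_iff γ₁ u w s
  have b12 := pat3_xs_iff γ₁ u w s
  have b13 := pat3_ys_iff γ₁ u w s
  have b21 := pat3_xy_iff γ₂ w v t
  have b22 := pat3_xs_iff γ₂ w v t
  have b23 := pat3_ys_iff γ₂ w v t
  -- symmetric forms of piece relations
  have sKuv : (openGraph (↑γK : BondConfig V)).Reachable u v ↔ (openGraph (↑γK : BondConfig V)).Reachable v u :=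
    ⟨Reachable.symm, Reachable.symm⟩
  have s1ws : (openGraph (↑γ₁ : BondConfig V)).Reachable s w ↔ (openGraph (↑γ₁ : BondConfig V)).Reachable w s :=
    ⟨Reachable.symm, Reachable.symm⟩
  -- the corners-joined bit
  have eUV : ((pat3 γK v u b).xy || ((pat3 γ₁ u w s).xy && (pat3 γ₂ w v t).xy)) = true ↔
      (openGraph (↑(γK ∪ (γ₁ ∪ γ₂)) : BondConfig V)).Reachable u v := by
    rw [Bool.or_eq_true, Bool.and_eq_true, bK1, b11, b21, Uuv, Buv, sKuv]
  have eVU : ((pat3 γK v u b).xy || ((pat3 γ₁ u w s).xy && (pat3 γ₂ w v t).xy)) = true ↔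
      (openGraph (↑(γK ∪ (γ₁ ∪ γ₂)) : BondConfig V)).Reachable v u :=
    eUV.trans ⟨Reachable.symm, Reachable.symm⟩
  -- `(part-disjunction) ↔ UV` in the four shapes produced by `reachable_union_par_third`
  have dj1 : ((openGraph (↑(γ₁ ∪ γ₂) : BondConfig V)).Reachable u v ∨ (openGraph (↑γK : BondConfig V)).Reachable u v) ↔
      (openGraph (↑(γK ∪ (γ₁ ∪ γ₂)) : BondConfig V)).Reachable u v := by rw [Uuv, or_comm]
  have dj2 : ((openGraph (↑(γ₁ ∪ γ₂) : BondConfig V)).Reachable v u ∨ (openGraph (↑γK : BondConfig V)).Reachable v u) ↔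
      (openGraph (↑(γK ∪ (γ₁ ∪ γ₂)) : BondConfig V)).Reachable v u := by
    rw [show (openGraph (↑(γ₁ ∪ γ₂) : BondConfig V)).Reachable v u ↔ (openGraph (↑(γ₁ ∪ γ₂) : BondConfig V)).Reachable u v
      from ⟨Reachable.symm, Reachable.symm⟩, ← sKuv, or_comm, ← Uuv]
    exact ⟨Reachable.symm, Reachable.symm⟩
  have dj3 : ((openGraph (↑γK : BondConfig V)).Reachable u v ∨ (openGraph (↑(γ₁ ∪ γ₂) : BondConfig V)).Reachable u v) ↔
      (openGraph (↑(γK ∪ (γ₁ ∪ γ₂)) : BondConfig V)).Reachable u v := Uuv.symm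
  have dj4 : ((openGraph (↑γK : BondConfig V)).Reachable v u ∨ (openGraph (↑(γ₁ ∪ γ₂) : BondConfig V)).Reachable v u) ↔
      (openGraph (↑(γK ∪ (γ₁ ∪ γ₂)) : BondConfig V)).Reachable v u := by
    rw [or_comm]; exact dj2
  -- the six mark/corner bits
  have eBU : ((pat3 γK v u b).ys || (((pat3 γK v u b).xy || ((pat3 γ₁ u w s).xy && (pat3 γ₂ w v t).xy)) &&
      (pat3 γK v u b).xs)) = true ↔ (openGraph (↑(γK ∪ (γ₁ ∪ γ₂)) : BondConfig V)).Reachable u b := by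
    rw [bool_or_and_iff' bK3 eUV bK2, Uub, dj1]
  have eBV : ((pat3 γK v u b).xs || (((pat3 γK v u b).xy || ((pat3 γ₁ u w s).xy && (pat3 γ₂ w v t).xy)) &&
      (pat3 γK v u b).ys)) = true ↔ (openGraph (↑(γK ∪ (γ₁ ∪ γ₂)) : BondConfig V)).Reachable v b := by
    rw [bool_or_and_iff' bK2 eVU bK3, Uvb, dj2]
  have eSU : ((pat3 γ₁ u w s).xs || (((pat3 γK v u b).xy || ((pat3 γ₁ u w s).xy && (pat3 γ₂ w v t).xy)) &&
      ((pat3 γ₁ u w s).ys && (pat3 γ₂ w v t).xy))) = true ↔ (openGraph (↑(γK ∪ (γ₁ ∪ γ₂)) : BondConfig V)).Reachable u s := by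
    have hvs : ((pat3 γ₁ u w s).ys && (pat3 γ₂ w v t).xy) = true ↔ (openGraph (↑(γ₁ ∪ γ₂) : BondConfig V)).Reachable v s := by
      rw [Bool.and_eq_true, b13, b21, ← s1ws, ← Bsv]; exact ⟨Reachable.symm, Reachable.symm⟩
    rw [bool_or_and_iff' b12 eUV hvs, Uus, Bus, dj3]
  have eSV : (((pat3 γ₁ u w s).ys && (pat3 γ₂ w v t).xy) || (((pat3 γK v u b).xy || ((pat3 γ₁ u w s).xy &&
      (pat3 γ₂ w v t).xy)) && (pat3 γ₁ u w s).xs)) = true ↔ (openGraph (↑(γK ∪ (γ₁ ∪ γ₂)) : BondConfig V)).Reachable v s := by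
    have hvs : ((pat3 γ₁ u w s).ys && (pat3 γ₂ w v t).xy) = true ↔ (openGraph (↑(γ₁ ∪ γ₂) : BondConfig V)).Reachable v s := by
      rw [Bool.and_eq_true, b13, b21, ← s1ws, ← Bsv]; exact ⟨Reachable.symm, Reachable.symm⟩
    have hus : (pat3 γ₁ u w s).xs = true ↔ (openGraph (↑(γ₁ ∪ γ₂) : BondConfig V)).Reachable u s := by rw [b12, Bus]
    rw [bool_or_and_iff' hvs eVU hus, Uvs, dj4]
  have eTU : (((pat3 γ₁ u w s).xy && (pat3 γ₂ w v t).xs) || (((pat3 γK v u b).xy || ((pat3 γ₁ u w s).xy &&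
      (pat3 γ₂ w v t).xy)) && (pat3 γ₂ w v t).ys)) = true ↔ (openGraph (↑(γK ∪ (γ₁ ∪ γ₂)) : BondConfig V)).Reachable u t := by
    have hut : ((pat3 γ₁ u w s).xy && (pat3 γ₂ w v t).xs) = true ↔ (openGraph (↑(γ₁ ∪ γ₂) : BondConfig V)).Reachable u t := by
      rw [Bool.and_eq_true, b11, b22, But]
    have hvt : (pat3 γ₂ w v t).ys = true ↔ (openGraph (↑(γ₁ ∪ γ₂) : BondConfig V)).Reachable v t := by rw [b23, Bvt]
    rw [bool_or_and_iff' hut eUV hvt, Uut, dj3]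
  have eTV : ((pat3 γ₂ w v t).ys || (((pat3 γK v u b).xy || ((pat3 γ₁ u w s).xy && (pat3 γ₂ w v t).xy)) &&
      ((pat3 γ₁ u w s).xy && (pat3 γ₂ w v t).xs))) = true ↔ (openGraph (↑(γK ∪ (γ₁ ∪ γ₂)) : BondConfig V)).Reachable v t := by
    have hut : ((pat3 γ₁ u w s).xy && (pat3 γ₂ w v t).xs) = true ↔ (openGraph (↑(γ₁ ∪ γ₂) : BondConfig V)).Reachable u t := by
      rw [Bool.and_eq_true, b11, b22, But]
    have hvt : (pat3 γ₂ w v t).ys = true ↔ (openGraph (↑(γ₁ ∪ γ₂) : BondConfig V)).Reachable v t := by rw [b23, Bvt]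
    rw [bool_or_and_iff' hvt eVU hut, Uvt, dj4]
  -- reoriented mark/mark relations
  have E1 : (openGraph (↑(γK ∪ (γ₁ ∪ γ₂)) : BondConfig V)).Reachable b s ↔
      ((openGraph (↑(γK ∪ (γ₁ ∪ γ₂)) : BondConfig V)).Reachable u b ∧ (openGraph (↑(γK ∪ (γ₁ ∪ γ₂)) : BondConfig V)).Reachable u s) ∨
        ((openGraph (↑(γK ∪ (γ₁ ∪ γ₂)) : BondConfig V)).Reachable v b ∧
          (openGraph (↑(γK ∪ (γ₁ ∪ γ₂)) : BondConfig V)).Reachable v s) := by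
    rw [Ubs]
    constructor
    · rintro (⟨h1, h2⟩ | ⟨h1, h2⟩)
      · exact Or.inl ⟨h1.symm, h2⟩
      · exact Or.inr ⟨h1.symm, h2⟩
    · rintro (⟨h1, h2⟩ | ⟨h1, h2⟩)
      · exact Or.inl ⟨h1.symm, h2⟩
      · exact Or.inr ⟨h1.symm, h2⟩
  have E2 : (openGraph (↑(γK ∪ (γ₁ ∪ γ₂)) : BondConfig V)).Reachable b t ↔
      ((openGraph (↑(γK ∪ (γ₁ ∪ γ₂)) : BondConfig V)).Reachable u b ∧ (openGraph (↑(γK ∪ (γ₁ ∪ γ₂)) : BondConfig V)).Reachable u t) ∨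
        ((openGraph (↑(γK ∪ (γ₁ ∪ γ₂)) : BondConfig V)).Reachable v b ∧
          (openGraph (↑(γK ∪ (γ₁ ∪ γ₂)) : BondConfig V)).Reachable v t) := by
    rw [Ubt]
    constructor
    · rintro (⟨h1, h2⟩ | ⟨h1, h2⟩)
      · exact Or.inl ⟨h1.symm, h2⟩
      · exact Or.inr ⟨h1.symm, h2⟩
    · rintro (⟨h1, h2⟩ | ⟨h1, h2⟩)
      · exact Or.inl ⟨h1.symm, h2⟩
      · exact Or.inr ⟨h1.symm, h2⟩
  have E3 : (openGraph (↑(γK ∪ (γ₁ ∪ γ₂)) : BondConfig V)).Reachable s t ↔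
      ((openGraph (↑γ₁ : BondConfig V)).Reachable w s ∧ (openGraph (↑γ₂ : BondConfig V)).Reachable w t) ∨
        ((openGraph (↑γ₁ : BondConfig V)).Reachable u s ∧ (openGraph (↑(γK ∪ (γ₁ ∪ γ₂)) : BondConfig V)).Reachable u t) ∨
          (((openGraph (↑γ₁ : BondConfig V)).Reachable w s ∧ (openGraph (↑γ₂ : BondConfig V)).Reachable w v) ∧
            (openGraph (↑(γK ∪ (γ₁ ∪ γ₂)) : BondConfig V)).Reachable v t) := by
    rw [Ust, Bst, s1ws]
    have e1 : (openGraph (↑(γ₁ ∪ γ₂) : BondConfig V)).Reachable s u ↔ (openGraph (↑γ₁ : BondConfig V)).Reachable u s := by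
      rw [← Bus]; exact ⟨Reachable.symm, Reachable.symm⟩
    have e2 : (openGraph (↑(γ₁ ∪ γ₂) : BondConfig V)).Reachable s v ↔
        (openGraph (↑γ₁ : BondConfig V)).Reachable w s ∧ (openGraph (↑γ₂ : BondConfig V)).Reachable w v := by
      rw [Bsv, s1ws]
    rw [e1, e2]
  -- assemble
  rw [hU, pat3_eq_ofBits]
  unfold joinRing
  have c1 := conn_iff (γK ∪ (γ₁ ∪ γ₂)) b s
  have c2 := conn_iff (γK ∪ (γ₁ ∪ γ₂)) b t
  have c3 := conn_iff (γK ∪ (γ₁ ∪ γ₂)) s t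
  have hws : ((pat3 γ₁ u w s).ys && (pat3 γ₂ w v t).xs) = true ↔
      (openGraph (↑γ₁ : BondConfig V)).Reachable w s ∧ (openGraph (↑γ₂ : BondConfig V)).Reachable w t := by
    rw [Bool.and_eq_true, b13, b22]
  have hwsv : ((pat3 γ₁ u w s).ys && (pat3 γ₂ w v t).xy) = true ↔
      (openGraph (↑γ₁ : BondConfig V)).Reachable w s ∧ (openGraph (↑γ₂ : BondConfig V)).Reachable w v := by
    rw [Bool.and_eq_true, b13, b21]
  congr 1
  · exact Bool.eq_iff_iff.2 (c1.trans (E1.trans (bool_or_and_iff eBU eSU eBV eSV).symm))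
  · exact Bool.eq_iff_iff.2 (c2.trans (E2.trans (bool_or_and_iff eBU eTU eBV eTV).symm))
  · exact Bool.eq_iff_iff.2 (c3.trans (E3.trans (bool_ring3_iff hws b12 eTU hwsv eTV).symm))

end Ring

/-! ### RING gluing: the antipodal exponent and the trilinear decomposition -/

section RingExp

variable [Fintype V] {EK E₁ E₂ : Finset (Sym2 V)} {VK V₁ V₂ : Set V} {u v w : V}

/-- **ANTIPODAL EXPONENT ACROSS A RING GLUING**: `k(γ)+k(γᶜ)+4|V| = Σ_p (k(γ_p)+k(γ_pᶜ)) + corrRing + corrRing'` — fk-2's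
`FK.apExp_series` inside `Q₁ ∪ Q₂` (glued at `w`) and `FK.apExp_parallel` for `K` across `{u, v}`; the correction is the one
cycle closed when all three pieces join their corners. [folklore] -/
theorem apExp_union3_ring (hdK1 : Disjoint EK E₁) (hdK2 : Disjoint EK E₂) (hd12 : Disjoint E₁ E₂)
    (hK : ∀ e ∈ (↑EK : Set (Sym2 V)), ∀ z ∈ e, z ∈ VK)
    (h₁ : ∀ e ∈ (↑E₁ : Set (Sym2 V)), ∀ z ∈ e, z ∈ V₁) (h₂ : ∀ e ∈ (↑E₂ : Set (Sym2 V)), ∀ z ∈ e, z ∈ V₂)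
    (hK1 : VK ∩ V₁ ⊆ ({u} : Set V)) (h12 : V₁ ∩ V₂ ⊆ ({w} : Set V)) (hK2 : VK ∩ V₂ ⊆ ({v} : Set V))
    (hu2 : u ∉ V₂) (hv1 : v ∉ V₁) (huv : u ≠ v) (huw : u ≠ w) (hvw : v ≠ w)
    (b s t : V) {γK γ₁ γ₂ : Finset (Sym2 V)} (gK : γK ⊆ EK) (g₁ : γ₁ ⊆ E₁) (g₂ : γ₂ ⊆ E₂) :
    apExp (EK ∪ E₁ ∪ E₂) (γK ∪ γ₁ ∪ γ₂) + 4 * Fintype.card V =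
      apExp EK γK + apExp E₁ γ₁ + apExp E₂ γ₂ + corrRing (pat3 γK v u b) (pat3 γ₁ u w s) (pat3 γ₂ w v t) +
        corrRing (pat3 (EK \ γK) v u b) (pat3 (E₁ \ γ₁) u w s) (pat3 (E₂ \ γ₂) w v t) := by
  have hd : Disjoint EK (E₁ ∪ E₂) := Finset.disjoint_union_right.2 ⟨hdK1, hdK2⟩
  have hB : ∀ e ∈ (↑(E₁ ∪ E₂) : Set (Sym2 V)), ∀ z ∈ e, z ∈ V₁ ∪ V₂ := edges_union_verts h₁ h₂
  have hSB : VK ∩ (V₁ ∪ V₂) ⊆ ({u, v} : Set V) := ring_inter_subset_pair hK1 hK2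
  have e1 := apExp_series hd12 h₁ h₂ h12 le_rfl le_rfl g₁ g₂
  have e2 := apExp_parallel hd hK hB hSB huv le_rfl le_rfl gK (Finset.union_subset_union g₁ g₂)
  have sK : (openGraph (↑γK : BondConfig V)).Reachable u v ↔ (openGraph (↑γK : BondConfig V)).Reachable v u :=
    ⟨Reachable.symm, Reachable.symm⟩
  have sK' : (openGraph (↑(EK \ γK) : BondConfig V)).Reachable u v ↔ (openGraph (↑(EK \ γK) : BondConfig V)).Reachable v u :=
    ⟨Reachable.symm, Reachable.symm⟩
  rw [ite_prop_eq_ite_bool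
      (p := (openGraph (↑γK : BondConfig V)).Reachable u v ∧ (openGraph (↑(γ₁ ∪ γ₂) : BondConfig V)).Reachable u v)
      (bb := (pat3 γK v u b).xy && (pat3 γ₁ u w s).xy && (pat3 γ₂ w v t).xy)
      (by rw [Bool.and_eq_true, Bool.and_eq_true, pat3_xy_iff, pat3_xy_iff, pat3_xy_iff,
        reachable_union_series h₁ h₂ h12 hu2 hv1 huw hvw huv g₁ g₂, sK, and_assoc]),
    ite_prop_eq_ite_bool
      (p := (openGraph (↑(EK \ γK) : BondConfig V)).Reachable u v ∧
        (openGraph (↑((E₁ ∪ E₂) \ (γ₁ ∪ γ₂)) : BondConfig V)).Reachable u v)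
      (bb := (pat3 (EK \ γK) v u b).xy && (pat3 (E₁ \ γ₁) u w s).xy && (pat3 (E₂ \ γ₂) w v t).xy)
      (by rw [Bool.and_eq_true, Bool.and_eq_true, pat3_xy_iff, pat3_xy_iff, pat3_xy_iff, union_sdiff_union hd12 g₁ g₂,
        reachable_union_series h₁ h₂ h12 hu2 hv1 huw hvw huv Finset.sdiff_subset Finset.sdiff_subset, sK', and_assoc])] at e2
  have eU : apExp (EK ∪ E₁ ∪ E₂) (γK ∪ γ₁ ∪ γ₂) = apExp (EK ∪ (E₁ ∪ E₂)) (γK ∪ (γ₁ ∪ γ₂)) := by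
    rw [Finset.union_assoc, Finset.union_assoc]
  unfold corrRing
  rw [eU]
  omega

/-- **TRILINEAR DECOMPOSITION OF `tval` OVER A RING GLUING** (census g32 §2.1, `r = 3`). [folklore] -/
theorem tval_union3_ring (hdK1 : Disjoint EK E₁) (hdK2 : Disjoint EK E₂) (hd12 : Disjoint E₁ E₂)
    (hK : ∀ e ∈ (↑EK : Set (Sym2 V)), ∀ z ∈ e, z ∈ VK)
    (h₁ : ∀ e ∈ (↑E₁ : Set (Sym2 V)), ∀ z ∈ e, z ∈ V₁) (h₂ : ∀ e ∈ (↑E₂ : Set (Sym2 V)), ∀ z ∈ e, z ∈ V₂)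
    (hK1 : VK ∩ V₁ ⊆ ({u} : Set V)) (h12 : V₁ ∩ V₂ ⊆ ({w} : Set V)) (hK2 : VK ∩ V₂ ⊆ ({v} : Set V))
    (hu2 : u ∉ V₂) (hv1 : v ∉ V₁) (huv : u ≠ v) (huw : u ≠ w) (hvw : v ≠ w)
    {b s t : V} (hb1 : b ∉ V₁) (hb2 : b ∉ V₂) (hsK : s ∉ VK) (hs2 : s ∉ V₂) (htK : t ∉ VK) (ht1 : t ∉ V₁)
    (hbu : b ≠ u) (hbv : b ≠ v) (hsu : s ≠ u) (hsv : s ≠ v) (hsw : s ≠ w) (htu : t ≠ u) (htv : t ≠ v) (htw : t ≠ w)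
    (hbs : b ≠ s) (hbt : b ≠ t) (hst : s ≠ t) (wt : ℕ → ℝ) (tab : Pat3 → Pat3 → ℤ) :
    tval (fun n => wt (n + 4 * Fintype.card V)) (EK ∪ E₁ ∪ E₂) b s t tab =
      ∑ γK ∈ EK.powerset, ∑ γ₁ ∈ E₁.powerset, ∑ γ₂ ∈ E₂.powerset,
        wt (apExp EK γK + apExp E₁ γ₁ + apExp E₂ γ₂ + corrRing (pat3 γK v u b) (pat3 γ₁ u w s) (pat3 γ₂ w v t) +
            corrRing (pat3 (EK \ γK) v u b) (pat3 (E₁ \ γ₁) u w s) (pat3 (E₂ \ γ₂) w v t)) *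
          (tab (joinRing (pat3 γK v u b) (pat3 γ₁ u w s) (pat3 γ₂ w v t))
            (joinRing (pat3 (EK \ γK) v u b) (pat3 (E₁ \ γ₁) u w s) (pat3 (E₂ \ γ₂) w v t)) : ℝ) := by
  have hd : Disjoint (EK ∪ E₁) E₂ := Finset.disjoint_union_left.2 ⟨hdK2, hd12⟩
  unfold tval
  beta_reduce
  rw [sum_powerset_union_disj hd]
  rw [sum_powerset_union_disj hdK1]
  refine Finset.sum_congr rfl fun γK hγK => Finset.sum_congr rfl fun γ₁ hγ₁ => Finset.sum_congr rfl fun γ₂ hγ₂ => ?_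
  have gK := Finset.mem_powerset.1 hγK
  have g₁ := Finset.mem_powerset.1 hγ₁
  have g₂ := Finset.mem_powerset.1 hγ₂
  rw [union_sdiff_union hd (Finset.union_subset_union gK g₁) g₂, union_sdiff_union hdK1 gK g₁,
    apExp_union3_ring hdK1 hdK2 hd12 hK h₁ h₂ hK1 h12 hK2 hu2 hv1 huv huw hvw b s t gK g₁ g₂,
    pat3_union3_ring hK h₁ h₂ hK1 h12 hK2 hu2 hv1 huv huw hvw hb1 hb2 hsK hs2 htK ht1 hbu hbv hsu hsv hsw htu htv htw hbs hbt
      hst gK g₁ g₂,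
    pat3_union3_ring hK h₁ h₂ hK1 h12 hK2 hu2 hv1 huv huw hvw hb1 hb2 hsK hs2 htK ht1 hbu hbv hsu hsv hsw htu htv htw hbs hbt
      hst Finset.sdiff_subset Finset.sdiff_subset Finset.sdiff_subset]

end RingExp

end FK

end Summit.CriticalPhenomena.PercolationContinuityZ3.Theorems

end
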